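import Summits.Schanuel.Schanuel.Theorems.RootDecomp1KHyper04

/-!
# RootDecomp1KHyper — part 5 of the «HyperCarving» port wave (lens 6, gen 9 = ROUND 4 of route-Schanuel-RootDecomp1K; 19 parts planned)

Mechanical port (census-1 gen 7, dependency closure; tools census/tools/gen7/portkit2.py + build_l6g9.py) of §17 of HOME/decomp-schanuel-lens-6/g9/HyperCarving.lean
(sha256 aba5c91f…, 8041 l; critic CLEARED FOR TYPING 2026-08-30T13:33:07Z; writer PATH A″ rev 5–8) together with the §§0–16 declarations it depends on
(nothing of the node was in the tree before except RootDecomp1KLinLiouvilleSplit and the Literature fact NesterenkoWaldschmidt1996_thm_5_1).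
This part: node lines 2954–3760 (23 declarations: exists_liouville_ratio_of_linLiouville, linearIndependent_pair_of_irrational, linLiouville_of_liouville_ratio, not_linLiouville_of_ratio_im_ne_zero, LinLiouvilleSchanuel, PolyDiophantineSchanuel …).
All parts share the namespace `Summit.Schanuel.Schanuel.Theorems.RootDecomp1KHyper` (node sub-namespace `HyperCell` reproduced); statements and proofs
are the node's verbatim; `--supports stmt-Schanuel-33363` (A₄ʰ HyperLiouvilleSchanuel). Sorry-free; standard axioms. Nothing here proves Schanuel; rung 0.
-/

set_option linter.dupNamespace false
set_option linter.unusedSectionVars false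

noncomputable section

open Complex IntermediateField Filter Polynomial
open Literature.Uncategorized (W78LogMeasure)

namespace Summit.Schanuel.Schanuel.Theorems.RootDecomp1KHyper

variable {n K : ℕ}

/-- **Structure of `LinLiouville` pairs.** A ℚ-free pair is `LinLiouville` only if
`z₁ = ρ · z₀` with `ρ` a real LIOUVILLE number (Mathlib `Liouville`). -/
theorem exists_liouville_ratio_of_linLiouville {z : Fin 2 → ℂ} (hz : LinearIndependent ℚ z)
    (hL : LinLiouville z) : ∃ ρ : ℝ, Liouville ρ ∧ z 1 = (ρ : ℂ) * z 0 := by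
  have h0 : z 0 ≠ 0 := hz.ne_zero 0
  have hn0 : 0 < ‖z 0‖ := norm_pos_iff.mpr h0
  set ρ : ℝ := (z 1 / z 0).re with hρdef
  have hρ : z 1 / z 0 = (ρ : ℂ) := by
    apply Complex.ext
    · simp [hρdef]
    · rw [ratio_im_eq_zero_of_linLiouville hz hL]; simp
  have hz1 : z 1 = (ρ : ℂ) * z 0 := by rw [← hρ, div_mul_cancel₀ _ h0]
  refine ⟨ρ, fun m => ?_, hz1⟩
  -- forms in terms of ρ
  have hform : ∀ h : Fin 2 → ℤ, ‖∑ i, (h i : ℂ) * z i‖ = ‖z 0‖ * |(h 0 : ℝ) + (h 1 : ℝ) * ρ| := by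
    intro h
    have e : ∑ i, (h i : ℂ) * z i = z 0 * (((h 0 : ℝ) + (h 1 : ℝ) * ρ : ℝ) : ℂ) := by
      rw [form_two, hz1]; push_cast; ring
    rw [e, norm_mul, Complex.norm_real, Real.norm_eq_abs]
  obtain ⟨c, hc⟩ := exists_half_pow_le hn0
  obtain ⟨h, hh, hlt⟩ := hL (2 * m + c)
  set S : ℝ := ∑ i, (|h i| : ℝ) with hSdef
  have hS1 : 1 ≤ S := one_le_hsum hh
  have hS2 : (2 : ℝ) ≤ 1 + S := by linarith
  rw [hform h] at hlt
  -- h 1 ≠ 0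
  have h1 : h 1 ≠ 0 := by
    intro h10
    have h00 : h 0 ≠ 0 := by
      intro h00; apply hh; funext i; fin_cases i <;> simp [h00, h10]
    have hge : ‖z 0‖ ≤ ‖z 0‖ * |(h 0 : ℝ) + (h 1 : ℝ) * ρ| := by
      simp only [h10, Int.cast_zero, zero_mul, add_zero]
      have : (1 : ℝ) ≤ |(h 0 : ℝ)| := by exact_mod_cast Int.one_le_abs h00
      exact le_mul_of_one_le_right hn0.le this
    have hb := linLiouville_bound_le_half_pow hh (2 * m + c)
    have hcc : 1 / (2 : ℝ) ^ (2 * m + c) ≤ 1 / 2 ^ c :=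
      one_div_le_one_div_of_le (by positivity) (pow_le_pow_right₀ (by norm_num) (by omega))
    linarith
  -- normalise the sign of h 1
  obtain ⟨a₀, b₀, hb₀, hS', hlt'⟩ : ∃ a₀ b₀ : ℤ, 0 < b₀ ∧ (|(a₀ : ℝ)| + |(b₀ : ℝ)| = S) ∧
      ‖z 0‖ * |(a₀ : ℝ) + (b₀ : ℝ) * ρ| < 1 / (1 + S) ^ (2 * m + c) := by
    rcases lt_or_gt_of_ne h1 with hneg | hpos
    · refine ⟨-h 0, -h 1, by omega, ?_, ?_⟩
      · rw [hSdef, hsum_two]; simp only [Int.cast_neg, abs_neg]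
      · have e : |((-h 0 : ℤ) : ℝ) + ((-h 1 : ℤ) : ℝ) * ρ| = |(h 0 : ℝ) + (h 1 : ℝ) * ρ| := by
          rw [show ((-h 0 : ℤ) : ℝ) + ((-h 1 : ℤ) : ℝ) * ρ = -((h 0 : ℝ) + (h 1 : ℝ) * ρ) by
            push_cast; ring, abs_neg]
        rw [e]; exact hlt
    · exact ⟨h 0, h 1, hpos, by rw [hSdef, hsum_two], hlt⟩
  have hb₀R : (0 : ℝ) < b₀ := by exact_mod_cast hb₀
  have hb₀1 : (1 : ℝ) ≤ b₀ := by exact_mod_cast hb₀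
  have hb₀ne : (b₀ : ℝ) ≠ 0 := hb₀R.ne'
  have hbS : (b₀ : ℝ) ≤ S := by
    rw [← hS', abs_of_pos hb₀R]; linarith [abs_nonneg (a₀ : ℝ)]
  -- the Liouville data: a := -2 a₀, b := 2 b₀
  refine ⟨-(2 * a₀), 2 * b₀, by omega, ?_, ?_⟩
  · -- ρ ≠ a/b : an exact relation would contradict ℚ-freeness
    intro hρeq
    have hrel : (a₀ : ℝ) + (b₀ : ℝ) * ρ = 0 := by
      rw [hρeq]; push_cast; field_simp; ring
    have hform0 : ∑ i, ((![a₀, b₀] : Fin 2 → ℤ) i : ℂ) * z i = 0 := by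
      have e : ∑ i, ((![a₀, b₀] : Fin 2 → ℤ) i : ℂ) * z i =
          z 0 * (((a₀ : ℝ) + (b₀ : ℝ) * ρ : ℝ) : ℂ) := by
        rw [form_two, hz1]
        simp only [Matrix.cons_val_zero, Matrix.cons_val_one]
        push_cast; ring
      rw [e, hrel]; simp
    have hne : (![a₀, b₀] : Fin 2 → ℤ) ≠ 0 := by
      intro h0'; have := congr_fun h0' 1; simp at this; omega
    exact form_ne_zero_of_linearIndependent hz hne hform0
  · -- |ρ - a/b| < 1 / b^m
    have hdist : |ρ - ((-(2 * a₀) : ℤ) : ℝ) / ((2 * b₀ : ℤ) : ℝ)| =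
        |(a₀ : ℝ) + (b₀ : ℝ) * ρ| / b₀ := by
      push_cast
      have e : ρ - -(2 * (a₀ : ℝ)) / (2 * (b₀ : ℝ)) = ((a₀ : ℝ) + (b₀ : ℝ) * ρ) / b₀ := by
        field_simp; ring
      rw [e, abs_div, abs_of_pos hb₀R]
    rw [hdist]
    -- chain: |a₀ + b₀ρ| / b₀ ≤ |a₀ + b₀ ρ| < (1/‖z0‖)(1+S)^{-(2m+c)} ≤ 1/(2 b₀)^m
    have hstep1 : |(a₀ : ℝ) + (b₀ : ℝ) * ρ| / b₀ ≤ |(a₀ : ℝ) + (b₀ : ℝ) * ρ| :=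
      div_le_self (abs_nonneg _) hb₀1
    have hstep2 : |(a₀ : ℝ) + (b₀ : ℝ) * ρ| < 1 / (‖z 0‖ * (1 + S) ^ (2 * m + c)) := by
      rw [lt_div_iff₀ (by positivity)]
      calc |(a₀ : ℝ) + (b₀ : ℝ) * ρ| * (‖z 0‖ * (1 + S) ^ (2 * m + c))
          = ‖z 0‖ * |(a₀ : ℝ) + (b₀ : ℝ) * ρ| * (1 + S) ^ (2 * m + c) := by ring
        _ < 1 / (1 + S) ^ (2 * m + c) * (1 + S) ^ (2 * m + c) := by gcongr
        _ = 1 := by field_simp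
    have hstep3 : 1 / (‖z 0‖ * (1 + S) ^ (2 * m + c)) ≤ 1 / ((2 * b₀ : ℤ) : ℝ) ^ m := by
      apply one_div_le_one_div_of_le (by positivity)
      -- (2 b₀)^m ≤ (1+S)^(2m) and 1 ≤ ‖z0‖ (1+S)^c
      have hA : ((2 * b₀ : ℤ) : ℝ) ^ m ≤ (1 + S) ^ (2 * m) := by
        push_cast
        rw [pow_mul]
        apply pow_le_pow_left₀ (by positivity)
        nlinarith [hbS, hS1, sq_nonneg S]
      have hB : (1 : ℝ) ≤ ‖z 0‖ * (1 + S) ^ c := by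
        have h2c : (2 : ℝ) ^ c ≤ (1 + S) ^ c := pow_le_pow_left₀ (by norm_num) hS2 c
        have hzc : 1 ≤ ‖z 0‖ * 2 ^ c := (div_le_iff₀ (by positivity)).mp hc
        calc (1 : ℝ) ≤ ‖z 0‖ * 2 ^ c := hzc
          _ ≤ ‖z 0‖ * (1 + S) ^ c := by gcongr
      calc ((2 * b₀ : ℤ) : ℝ) ^ m ≤ (1 + S) ^ (2 * m) * 1 := by rw [mul_one]; exact hA
        _ ≤ (1 + S) ^ (2 * m) * (‖z 0‖ * (1 + S) ^ c) := by gcongr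
        _ = ‖z 0‖ * (1 + S) ^ (2 * m + c) := by rw [pow_add]; ring
    exact lt_of_le_of_lt hstep1 (lt_of_lt_of_le hstep2 hstep3)

/-- A pair `(t, ρt)` with `t ≠ 0` and `ρ` real irrational is ℚ-free. -/
theorem linearIndependent_pair_of_irrational {t : ℂ} (ht : t ≠ 0) {ρ : ℝ} (hρ : Irrational ρ) :
    LinearIndependent ℚ ![t, (ρ : ℂ) * t] := by
  rw [LinearIndependent.pair_iff]
  intro s u hsu
  have hsu' : t * (((s : ℝ) : ℂ) + ((u : ℝ) : ℂ) * (ρ : ℂ)) = 0 := by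
    have e : t * (((s : ℝ) : ℂ) + ((u : ℝ) : ℂ) * (ρ : ℂ)) = s • t + u • ((ρ : ℂ) * t) := by
      simp only [Rat.smul_def]; push_cast; ring
    rw [e]; exact hsu
  have h2 : ((s : ℝ) : ℂ) + ((u : ℝ) : ℂ) * (ρ : ℂ) = 0 := by
    rcases mul_eq_zero.mp hsu' with h | h
    · exact absurd h ht
    · exact h
  have hR : (s : ℝ) + (u : ℝ) * ρ = 0 := by exact_mod_cast h2
  by_cases hu : u = 0
  · simp [hu] at hR
    exact ⟨by exact_mod_cast hR, hu⟩
  · exfalso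
    have : ρ = ((-s / u : ℚ) : ℝ) := by
      have huR : (u : ℝ) ≠ 0 := by exact_mod_cast hu
      push_cast
      field_simp
      linarith
    exact hρ ⟨-s / u, this.symm⟩

/-- Conversely, **`(t, ρt)` is `LinLiouville` for every real Liouville `ρ` and every `t`**:
the Liouville approximations `a/b` of `ρ` give the small forms `−a·t + b·(ρt) = t (bρ − a)`. -/
theorem linLiouville_of_liouville_ratio {ρ : ℝ} (hρ : Liouville ρ) (t : ℂ) :
    LinLiouville ![t, (ρ : ℂ) * t] := by
  intro ω
  obtain ⟨c, hc⟩ := exists_le_two_pow (‖t‖ * (|ρ| + 3) ^ ω)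
  obtain ⟨a, b, hb1, -, hlt⟩ := hρ (ω + c + 1)
  have hb2Z : (2 : ℤ) ≤ b := by omega
  have hb2 : (2 : ℝ) ≤ b := by exact_mod_cast hb2Z
  have hbR : (1 : ℝ) < b := by linarith
  have hb0 : (0 : ℝ) < b := by linarith
  have hbne : (b : ℝ) ≠ 0 := hb0.ne'
  refine ⟨![-a, b], ?_, ?_⟩
  · intro h0
    have := congr_fun h0 1
    simp at this
    omega
  · have e : ∑ i, ((![-a, b] : Fin 2 → ℤ) i : ℂ) * (![t, (ρ : ℂ) * t] : Fin 2 → ℂ) i =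
        t * (((b : ℝ) * ρ - a : ℝ) : ℂ) := by
      rw [Fin.sum_univ_two]
      simp only [Matrix.cons_val_zero, Matrix.cons_val_one]
      push_cast; ring
    have eS : ∑ i, (|(![-a, b] : Fin 2 → ℤ) i| : ℝ) = |(a : ℝ)| + b := by
      rw [hsum_two]
      simp only [Matrix.cons_val_zero, Matrix.cons_val_one, Int.cast_neg,
        abs_neg, abs_of_pos hb0]
    rw [e, eS, norm_mul, Complex.norm_real, Real.norm_eq_abs]
    -- `|bρ − a| < 1 / b^(ω+c)`
    have h1 : |(b : ℝ) * ρ - a| < 1 / (b : ℝ) ^ (ω + c) := by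
      have e2 : (b : ℝ) * ρ - a = b * (ρ - a / b) := by field_simp
      rw [e2, abs_mul, abs_of_pos hb0]
      calc (b : ℝ) * |ρ - a / b| < b * (1 / (b : ℝ) ^ (ω + c + 1)) := by gcongr
        _ = 1 / (b : ℝ) ^ (ω + c) := by rw [pow_succ]; field_simp
    -- `|a| ≤ b (|ρ| + 1)`, whence `1 + |a| + b ≤ b (|ρ| + 3)`
    have ha : |(a : ℝ)| ≤ b * (|ρ| + 1) := by
      have h2 : |ρ - a / b| < 1 := by
        refine hlt.trans_le ?_
        rw [div_le_one (by positivity)]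
        exact one_le_pow₀ hbR.le
      have h3 : |(a : ℝ) / b| ≤ |ρ| + 1 := by
        have h4 : |(a : ℝ) / b| - |ρ| ≤ |(a : ℝ) / b - ρ| := abs_sub_abs_le_abs_sub _ _
        rw [abs_sub_comm] at h4
        linarith
      rw [abs_div, abs_of_pos hb0, div_le_iff₀ hb0] at h3
      linarith
    have hS : 1 + (|(a : ℝ)| + b) ≤ (|ρ| + 3) * b := by nlinarith [abs_nonneg ρ]
    have hpos : (0 : ℝ) < (1 + (|(a : ℝ)| + b)) ^ ω := by positivity
    rcases eq_or_ne t 0 with rfl | ht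
    · rw [norm_zero, zero_mul]; positivity
    · have htpos : 0 < ‖t‖ := norm_pos_iff.mpr ht
      have h2c : (2 : ℝ) ^ c ≤ (b : ℝ) ^ c := pow_le_pow_left₀ (by norm_num) hb2 c
      calc ‖t‖ * |(b : ℝ) * ρ - a| < ‖t‖ * (1 / (b : ℝ) ^ (ω + c)) :=
            mul_lt_mul_of_pos_left h1 htpos
        _ = ‖t‖ / ((b : ℝ) ^ c * (b : ℝ) ^ ω) := by rw [pow_add]; ring
        _ ≤ ‖t‖ / ((2 : ℝ) ^ c * (b : ℝ) ^ ω) := by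
            apply div_le_div_of_nonneg_left htpos.le (by positivity)
            exact mul_le_mul_of_nonneg_right h2c (by positivity)
        _ ≤ ‖t‖ / (‖t‖ * (|ρ| + 3) ^ ω * (b : ℝ) ^ ω) := by
            apply div_le_div_of_nonneg_left htpos.le (by positivity)
            exact mul_le_mul_of_nonneg_right hc (by positivity)
        _ = 1 / ((|ρ| + 3) * b) ^ ω := by
            rw [mul_pow]; field_simp
        _ ≤ 1 / (1 + (|(a : ℝ)| + b)) ^ ω := by
            apply one_div_le_one_div_of_le hpos
            exact pow_le_pow_left₀ (by positivity) hS ω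

/-- A pair whose ratio is not real is not `LinLiouville`. -/
theorem not_linLiouville_of_ratio_im_ne_zero {z : Fin 2 → ℂ} (hz : LinearIndependent ℚ z)
    (him : (z 1 / z 0).im ≠ 0) : ¬ LinLiouville z :=
  fun hL => him (ratio_im_eq_zero_of_linLiouville hz hL)

/-- **Piece A₃ — `LinLiouvilleSchanuel`** (crux, round 3; child 1 of the split of
`StrictDiophantineSchanuel`): Schanuel's bound for the ℚ-free tuples `z` that are LIOUVILLE AS
LINEAR FORMS — for every `ω` some non-zero `h ∈ ℤⁿ` has `‖Σ hᵢzᵢ‖ < (1 + Σ|hᵢ|)^{−ω}`.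
WEAKER (Schanuel → A₃; fail-alone world: the Euler tuple `(1, iπ)` is outside its scope,
`not_linLiouville_one_pi_I`); contains the complement of barrier B3's Technical Hypothesis
(`linLiouville_of_not_technicalHypothesis`); ATTACKABLE: level 2 decided on every pair whose
Schanuel field holds a number with a polynomial transcendence measure (§13), reduced at level 2
to the dark Liouville pairs (`linLiouvilleSchanuel_two_iff_dark`). -/
def LinLiouvilleSchanuel : Prop :=
  ∀ (n : ℕ) (z : Fin n → ℂ), LinearIndependent ℚ z →
    (∀ ω : ℕ, ∃ h : Fin n → ℤ, h ≠ 0 ∧ ‖∑ i, (h i : ℂ) * z i‖ < 1 / (1 + ∑ i, (|h i| : ℝ)) ^ ω) →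
    (n : Cardinal) ≤ Algebra.trdeg ℚ ↥(IntermediateField.adjoin ℚ (Set.range z ∪ Set.range (Complex.exp ∘ z)))

/-- **Piece B₃ — `PolyDiophantineSchanuel`** (crux, DECLARED RESIDUAL of round 3; child 2 of the
split of `StrictDiophantineSchanuel`): Schanuel's bound for the ℚ-free tuples NO element of whose
span has a Liouville coordinate AND which carry a polynomial measure of linear independence
(some `ω` with `‖Σ hᵢzᵢ‖ ≥ (1 + Σ|hᵢ|)^{−ω}` for all `h ≠ 0`).  Scope ⊊ scope of
`StrictDiophantineSchanuel` (`residual_shrinks₃`: Lebesgue-almost every real direction through a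
Liouville ratio left it); every tuple in scope satisfies barrier B3's (T.H.)
(`technicalHypothesis_of_not_linLiouville`), so `SchanuelUnderTH` (stmt-Schanuel-3816) implies
it; still contains `(1, iπ)`, `(iπ, π)` (hypothesis-free) and `(1, e)` (mod NW). UNDECIDED;
test: Schanuel at `(1, iπ)`, i.e. `e, π` algebraically independent. -/
def PolyDiophantineSchanuel : Prop :=
  ∀ (n : ℕ) (z : Fin n → ℂ), LinearIndependent ℚ z →
    (¬ ∃ w ∈ Submodule.span ℚ (Set.range z), Liouville w.re ∨ Liouville w.im) →
    (¬ ∀ ω : ℕ, ∃ h : Fin n → ℤ, h ≠ 0 ∧ ‖∑ i, (h i : ℂ) * z i‖ < 1 / (1 + ∑ i, (|h i| : ℝ)) ^ ω) →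
    (n : Cardinal) ≤ Algebra.trdeg ℚ ↥(IntermediateField.adjoin ℚ (Set.range z ∪ Set.range (Complex.exp ∘ z)))

/-- **GLUE of the split `StrictDiophantineSchanuel ⟸ LinLiouvilleSchanuel ∧ PolyDiophantineSchanuel`**
(excluded middle on `LinLiouville z`).  This is the `--glue` statement
`LinLiouvilleSchanuel → PolyDiophantineSchanuel → StrictDiophantineSchanuel` of the route edit,
proved. -/
theorem strictDiophantineSchanuel_of_pieces₃ (hA : LinLiouvilleSchanuel)
    (hB : PolyDiophantineSchanuel) : StrictDiophantineSchanuel := by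
  intro n z hz hD
  by_cases hL : LinLiouville z
  · exact hA n z hz hL
  · exact hB n z hz hD hL

/-- **Deciding theorem, round 3.** `S_L′ → A₃ → B₃ → Schanuel`. -/
theorem closes₄ (hL : CoordLiouvilleSchanuel) (hA : LinLiouvilleSchanuel)
    (hB : PolyDiophantineSchanuel) : _root_.Schanuel :=
  closes₂ hL (strictDiophantineSchanuel_of_pieces₃ hA hB)

/-- §12a. The glue (round-3 split of the residual), the node, exactness: auxiliary statement `polyDiophantineSchanuel_of_strictDiophantineSchanuel` (lens 6 gen 9 node, ported verbatim). -/
theorem polyDiophantineSchanuel_of_strictDiophantineSchanuel (h : StrictDiophantineSchanuel) :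
    PolyDiophantineSchanuel :=
  fun n z hz hD _ => h n z hz hD

/-- §12a. The glue (round-3 split of the residual), the node, exactness: auxiliary statement `polyDiophantineSchanuel_of_schanuel` (lens 6 gen 9 node, ported verbatim). -/
theorem polyDiophantineSchanuel_of_schanuel (h : _root_.Schanuel) : PolyDiophantineSchanuel :=
  polyDiophantineSchanuel_of_strictDiophantineSchanuel (strictDiophantineSchanuel_of_schanuel h)

/-- §13. ROUND 3 — the level-2 storey of A₃: decided cells and the exact reduction to dark pai: auxiliary statement `ratio_mem_adjoin` (lens 6 gen 9 node, ported verbatim). -/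
theorem ratio_mem_adjoin (z : Fin 2 → ℂ) : z 1 / z 0 ∈ adjoin ℚ (SFset z ∪ {I}) :=
  div_mem (mem_adjoin_SFset_I (Or.inl ⟨1, rfl⟩)) (mem_adjoin_SFset_I (Or.inl ⟨0, rfl⟩))

/-- **MASTER CELL of round 3.** A measured `θ` in the Schanuel field of a ℚ-free `LinLiouville`
pair decides Schanuel there. -/
theorem sb_two_of_linLiouville_of_polyMeasure {θ : ℂ} (hθ : PolyMeasure θ) {z : Fin 2 → ℂ}
    (hz : LinearIndependent ℚ z) (hL : LinLiouville z) (hθz : θ ∈ adjoin ℚ (SFset z ∪ {I})) :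
    SB 2 z := by
  obtain ⟨ρ, hρ, h1⟩ := exists_liouville_ratio_of_linLiouville hz hL
  have hρmem : (ρ : ℂ) ∈ adjoin ℚ (SFset z ∪ {I}) := by
    have e : (ρ : ℂ) = z 1 / z 0 := by rw [h1, mul_div_cancel_right₀ _ (hz.ne_zero 0)]
    rw [e]; exact ratio_mem_adjoin z
  exact sb_two_of_polyMeasure_liouville hθ hρ hθz hρmem

/-- **Generic cell**: if some `zᵢ` is algebraically independent of `e^{zᵢ}`, `SB 2 z` outright. -/
theorem sb_two_of_algebraicIndependent_exp {z : Fin 2 → ℂ} (i : Fin 2)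
    (hai : AlgebraicIndependent ℚ ![z i, cexp (z i)]) : SB 2 z :=
  sb_two_of_algebraicIndependent hai (mem_adjoin_SFset_I (Or.inl ⟨i, rfl⟩))
    (mem_adjoin_SFset_I (Or.inr ⟨i, rfl⟩))

/-- Cell «an algebraic coordinate» (mod `hW`): `e^{zᵢ}` is measured (Waldschmidt 1978 Cor. 3.9,
tree-proved). -/
theorem cell₃_exp_algebraic (hW : WMeasure) {z : Fin 2 → ℂ} (hz : LinearIndependent ℚ z)
    (hL : LinLiouville z) (i : Fin 2) (hβ : IsAlgebraic ℚ (z i)) : SB 2 z :=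
  sb_two_of_linLiouville_of_polyMeasure (polyMeasure_exp_of_W hW hβ (hz.ne_zero i)) hz hL
    (mem_adjoin_SFset_I (Or.inr ⟨i, rfl⟩))

/-- Cell «a logarithm of an algebraic number among the coordinates» (mod `hlm`, Waldschmidt
1978 Cor. 3.7 = Cijsouw's measure). -/
theorem cell₃_log (hlm : W78LogMeasure) {z : Fin 2 → ℂ} (hz : LinearIndependent ℚ z)
    (hL : LinLiouville z) (i : Fin 2) (hα : IsAlgebraic ℚ (cexp (z i))) : SB 2 z :=
  sb_two_of_linLiouville_of_polyMeasure (polyMeasure_log_of_W78 hlm (hz.ne_zero i) hα) hz hL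
    (mem_adjoin_SFset_I (Or.inl ⟨i, rfl⟩))

/-- **Schanuel at the dark Liouville pairs**: `t` and `e^t` both transcendental but
algebraically dependent, `ρ` a real Liouville number; Schanuel's bound at `(t, ρt)`. -/
def DarkLiouvillePairSchanuel : Prop :=
  ∀ (t : ℂ) (ρ : ℝ), Liouville ρ → Transcendental ℚ t → Transcendental ℚ (cexp t) →
    ¬ AlgebraicIndependent ℚ ![t, cexp t] →
    (2 : Cardinal) ≤ Algebra.trdeg ℚ ↥(IntermediateField.adjoin ℚ
      (Set.range ![t, (ρ : ℂ) * t] ∪ Set.range (cexp ∘ ![t, (ρ : ℂ) * t])))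

/-- **Mahler class of one-dimensional exponential-algebraic points** (a Diophantine statement,
sufficient for the dark pairs; IDEA-NEEDED leaf): a transcendental `t` with `e^t` transcendental
and `t, e^t` algebraically dependent has a polynomial transcendence measure (is an S- or
T-number). Open in print to our knowledge (the simultaneous measure of Nesterenko–Waldschmidt
1996, Thm 1, gives `exp(−c (log H)²)` at such points, not a polynomial one). -/
def ExpCurveMahler : Prop :=
  ∀ t : ℂ, Transcendental ℚ t → Transcendental ℚ (cexp t) → ¬ AlgebraicIndependent ℚ ![t, cexp t] →
    PolyMeasure t

/-- §13b. Level 2 of A₃ is EXACTLY Schanuel at the dark Liouville pairs: auxiliary statement `transcendental_ne_zero` (lens 6 gen 9 node, ported verbatim). -/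
theorem transcendental_ne_zero {t : ℂ} (ht : Transcendental ℚ t) : t ≠ 0 :=
  fun h0 => ht (by rw [h0]; exact isAlgebraic_zero)

/-- Level 1 of A₃ is vacuous: a non-zero singleton is never `LinLiouville`. -/
theorem not_linLiouville_one {z : Fin 1 → ℂ} (hz : LinearIndependent ℚ z) : ¬ LinLiouville z := by
  intro hL
  have h0 : z 0 ≠ 0 := hz.ne_zero 0
  have hn0 : 0 < ‖z 0‖ := norm_pos_iff.mpr h0
  obtain ⟨c, hc⟩ := exists_half_pow_le hn0
  obtain ⟨h, hh, hlt⟩ := hL c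
  have hh0 : h 0 ≠ 0 := by
    intro e; apply hh; funext i; fin_cases i; simpa using e
  have h1 : (1 : ℝ) ≤ |(h 0 : ℝ)| := by exact_mod_cast Int.one_le_abs hh0
  have hform : ‖∑ i, (h i : ℂ) * z i‖ = |(h 0 : ℝ)| * ‖z 0‖ := by
    rw [Fin.sum_univ_one, norm_mul, Complex.norm_intCast]
  rw [hform] at hlt
  have hb := linLiouville_bound_le_half_pow hh c
  nlinarith

/-- §14a. Fail-alone worlds: the flagships are in B₃'s scope, (π, ℓπ) is in A₃'s: auxiliary statement `linearIndependent_one_pi_I` (lens 6 gen 9 node, ported verbatim). -/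
private theorem linearIndependent_one_pi_I : LinearIndependent ℚ ![(1 : ℂ), (Real.pi : ℂ) * I] := by
  rw [LinearIndependent.pair_iff]
  intro s t hst
  have hst' : ((s : ℝ) : ℂ) * 1 + ((t : ℝ) : ℂ) * ((Real.pi : ℂ) * I) = 0 := by
    simpa [Rat.smul_def] using hst
  have ht0 : t = 0 := by
    have := congrArg Complex.im hst'
    simpa [Real.pi_ne_zero] using this
  have hs0 : s = 0 := by
    have := congrArg Complex.re hst'
    simpa [ht0] using this
  exact ⟨hs0, ht0⟩

/-- **The Euler tuple `(1, iπ)` is not `LinLiouville`** (ratio `iπ ∉ ℝ`) — hypothesis-free. -/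
theorem not_linLiouville_one_pi_I : ¬ LinLiouville ![(1 : ℂ), (Real.pi : ℂ) * I] :=
  not_linLiouville_of_ratio_im_ne_zero linearIndependent_one_pi_I (by simp [Real.pi_ne_zero])

namespace HyperCell

variable {n K : ℕ}

/-- **Hyper-Liouville reals**: rational approximations `|ρ − p/q| < exp(−q^m)` for every `m`
(with `q → ∞`).  A dense `G_δ` of reals (hence comeagre), Lebesgue-null, contained in the
Liouville numbers (`HyperLiouville.liouville`); e.g. `Σ_k 10^{-a_k}` with `a_{k+1} ≥ 10^{k a_k}`. -/
def HyperLiouville (ρ : ℝ) : Prop :=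
  ∀ m : ℕ, ∃ r : ℚ, m ≤ r.den ∧ ρ ≠ r ∧ |ρ - r| < Real.exp (-((r.den : ℝ) ^ m))

/-- §16. An e^ℓ-LOAD-BEARING decided cell: (ρ, e^ρ) algebraically independent for: auxiliary statement `pow_le_exp_pow` (lens 6 gen 9 node, ported verbatim). -/
theorem pow_le_exp_pow {d : ℝ} (hd : 1 ≤ d) {n m : ℕ} (hnm : n ≤ m) :
    d ^ n ≤ Real.exp (d ^ m) :=
  (pow_le_pow_right₀ hd hnm).trans (by linarith [Real.add_one_le_exp (d ^ m)])

end HyperCell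

end Summit.Schanuel.Schanuel.Theorems.RootDecomp1KHyper
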